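import Mathlib
import Summits.Ventures.LatticeQCDFlow.Scaling.ImportanceWeights
import Summits.Ventures.LatticeQCDFlow.Exactness.FlowMCMC

/-!
# LatticeQCDFlow / Scaling — acceptance and ESS FLOORS from a log-weight oscillation bound

HONEST FRAMING: exact (Metropolis-corrected) sampling algorithms for lattice gauge theory;
figures of merit are autocorrelation/cost numbers at stated couplings and volumes; no
continuum-physics claim.

Venture `LatticeQCDFlow` (cell pub-lqcd), topic `Scaling`; authored by the theory-1 seat
(HOME/THEORY-1.md §10.5, FANOUT-theory1 R-T1-6), stated over the definitions of record
`Theory2.weight`, `Theory2.essFrac` (`Scaling/ImportanceWeights.lean`) and `Exactness.accRate`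
(`Exactness/FlowMCMC.lean`).  Finite state spaces.

These are the LOWER companions of theory-2's upper bounds (`accRate_le`, `essFrac_le_exp_neg_kl`,
`essFrac_prodLaw`): if the importance weights `w = p/q` of a normalised target `p` against a
normalised, fully supported model `q` OSCILLATE by at most `e^K`
(`p x · q y ≤ e^K · p y · q x` for all `x, y`, i.e. `max w / min w ≤ e^K`), then
* `accRate_ge_exp_neg` — the mean independence-Metropolis acceptance at stationarity is `≥ e^{−K}`;
* `essFrac_ge_exp_neg` — the Kish ESS fraction is `≥ e^{−K}`.
For a truncated (order-`N`) analytic trivializing map the oscillation exponent `K` is controlled by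
the sup-norm of the flow-equation defect (THEORY-1.md §10.2–10.4: `K ≤ 2·sup|D|`, and
`sup|D| ≤ β^{N+2} b_N |E|` with `b_N` volume-independent), so together with the product law these
two lemmas give the two-sided VOLUME LAW `e^{−c|E|} ≤ acceptance ≤ e^{−c′V}` for near-product
proposals.  Elementary finite sums; `[folklore]` level.
-/

namespace Summit.Ventures.LatticeQCDFlow.Scaling

open Finset
open Literature.Probability.MarkovChains
open Summit.Ventures.LatticeQCDFlow.Theory2
open Summit.Ventures.LatticeQCDFlow.Exactness

variable {X : Type*} [Fintype X]

/-- **Acceptance floor.** If the importance weights of two probability vectors oscillate by at most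
`e^K` (`p x · q y ≤ e^K · p y · q x` for all `x, y`), the mean independence-Metropolis acceptance
`accRate p q = ∑_x ∑_y min (p x q y) (p y q x)` is at least `e^{-K}`. [folklore] -/
theorem accRate_ge_exp_neg (p q : X → ℝ) (hp : ∀ x, 0 ≤ p x) (hq : ∀ x, 0 ≤ q x)
    (hp1 : ∑ x, p x = 1) (hq1 : ∑ x, q x = 1) {K : ℝ} (hK : 0 ≤ K)
    (hosc : ∀ x y, p x * q y ≤ Real.exp K * (p y * q x)) :
    Real.exp (-K) ≤ accRate p q := by
  have key : ∀ x y, Real.exp (-K) * (p x * q y) ≤ min (p x * q y) (p y * q x) := by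
    intro x y
    refine le_min ?_ ?_
    · have h1 : Real.exp (-K) ≤ 1 := Real.exp_le_one_iff.mpr (by linarith)
      have h2 : 0 ≤ p x * q y := mul_nonneg (hp x) (hq y)
      nlinarith
    · rw [Real.exp_neg, inv_mul_le_iff₀ (Real.exp_pos K)]
      exact hosc x y
  calc Real.exp (-K) = Real.exp (-K) * ((∑ x, p x) * ∑ y, q y) := by rw [hp1, hq1]; ring
    _ = ∑ x, ∑ y, Real.exp (-K) * (p x * q y) := by
        rw [Finset.sum_mul_sum, Finset.mul_sum]
        refine Finset.sum_congr rfl fun x _ => ?_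
        rw [Finset.mul_sum]
    _ ≤ accRate p q := Finset.sum_le_sum fun x _ => Finset.sum_le_sum fun y _ => key x y

/-- **ESS floor.** Under the same oscillation bound, for a fully supported model `q`, the Kish ESS
fraction `essFrac p q = (E_q w)² / E_q[w²]` is at least `e^{-K}`. [folklore] -/
theorem essFrac_ge_exp_neg (p q : X → ℝ) (hp : ∀ x, 0 ≤ p x) (hq : ∀ x, 0 < q x)
    (hp1 : ∑ x, p x = 1) (hq1 : ∑ x, q x = 1) {K : ℝ}
    (hosc : ∀ x y, p x * q y ≤ Real.exp K * (p y * q x)) :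
    Real.exp (-K) ≤ essFrac p q := by
  have hw : ∀ x, q x * weight p q x = p x := fun x => mul_weight (hq x).ne'
  -- each weight is at most e^K (average the oscillation bound over y)
  have hwle : ∀ x, weight p q x ≤ Real.exp K := by
    intro x
    have hsum : ∑ y, p x * q y ≤ ∑ y, Real.exp K * (p y * q x) :=
      Finset.sum_le_sum fun y _ => hosc x y
    rw [← Finset.mul_sum, hq1, mul_one, ← Finset.mul_sum] at hsum
    have : ∑ y, p y * q x = q x := by rw [← Finset.sum_mul, hp1, one_mul]
    rw [this] at hsum
    unfold weight
    rw [div_le_iff₀ (hq x)]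
    exact hsum
  have hnum : (∑ x, q x * weight p q x) ^ 2 = 1 := by simp_rw [hw, hp1, one_pow]
  have hden_le : ∑ x, q x * weight p q x ^ 2 ≤ Real.exp K := by
    calc ∑ x, q x * weight p q x ^ 2 = ∑ x, p x * weight p q x := by
          refine Finset.sum_congr rfl fun x _ => ?_
          rw [sq, ← mul_assoc, hw]
      _ ≤ ∑ x, p x * Real.exp K :=
          Finset.sum_le_sum fun x _ => mul_le_mul_of_nonneg_left (hwle x) (hp x)
      _ = Real.exp K := by rw [← Finset.sum_mul, hp1, one_mul]
  have hden_pos : 0 < ∑ x, q x * weight p q x ^ 2 := by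
    have hex : ∃ x, 0 < p x := by
      by_contra! h
      have : ∑ x, p x ≤ 0 := Finset.sum_nonpos fun x _ => h x
      linarith
    obtain ⟨x₀, hx₀⟩ := hex
    have hterm : ∀ x, 0 ≤ q x * weight p q x ^ 2 := fun x => mul_nonneg (hq x).le (sq_nonneg _)
    have hx₀' : 0 < q x₀ * weight p q x₀ ^ 2 := by
      have : 0 < weight p q x₀ := div_pos hx₀ (hq x₀)
      exact mul_pos (hq x₀) (pow_pos this 2)
    exact lt_of_lt_of_le hx₀' (Finset.single_le_sum (fun x _ => hterm x) (Finset.mem_univ x₀))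
  unfold essFrac
  rw [hnum, Real.exp_neg, one_div]
  exact inv_anti₀ hden_pos hden_le

/-- The two floors combined with theory-2's ceiling `accRate_le`: under the oscillation bound the mean
acceptance is pinned in `[e^{-K}, 1 - ‖p - q‖_TV]`. [folklore] -/
theorem exp_neg_le_accRate_le [DecidableEq X] (p q : X → ℝ) (hp : ∀ x, 0 ≤ p x) (hq : ∀ x, 0 ≤ q x)
    (hp1 : ∑ x, p x = 1) (hq1 : ∑ x, q x = 1) {K : ℝ} (hK : 0 ≤ K)
    (hosc : ∀ x y, p x * q y ≤ Real.exp K * (p y * q x)) :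
    Real.exp (-K) ≤ accRate p q ∧ accRate p q ≤ 1 - tvDist p q :=
  ⟨accRate_ge_exp_neg p q hp hq hp1 hq1 hK hosc, accRate_le hp1 hq1⟩

end Summit.Ventures.LatticeQCDFlow.Scaling
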